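import Mathlib.Topology.UniformSpace.HeineCantor
import Mathlib.Topology.Order.Compact
import Mathlib.Topology.MetricSpace.Pseudo.Defs
import Literature.Geometry.Lorentzian.KerrTimelikeSpan
import Literature.Geometry.Lorentzian.KerrHawkingField
import HarnessLib

/-!
# Uniform timelike Killing shells on sub-extremal Kerr at bounded surface gravity

Stub `S` (`stub_uniformKillingShells`) of the line `bounded-kappa-closing-box` for the crux
`BulkKerrCaptureC2` (route `PhaseMixingCapture`): the shell-uniform, quantitative form of
Dafermos–Rodnianski–Shlapentokh-Rothman, arXiv:1402.7034, Lemma 4.7.1. For every spin bound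
`a₁ < 1`, inner margin `c₁ > 0` and outer radius `R` there are a shell half-width `d > 0` and a
margin `μ > 0`, depending only on `(a₁, c₁, R)`, such that for every mass `M > 0`, every spin
`|a| ≤ a₁ M`, every centre `r₀ ∈ [r₊ + c₁ M, R M]` and every point `x` of the Kerr–Schild chart
with `|r_a(x) − r₀| ≤ d M`, the CONSTANT-coefficient Killing vector
`V = T + ω(r₀) Φ = ∂₀ + ω(r₀) (x₁ ∂₂ − x₂ ∂₁)`, `ω(r₀) = 2 M a r₀ / (r₀² + a²)²`
(`Kerr.drsrAngularVelocity M a r₀`), satisfies `g_{M,a}(x)(V, V) ≤ −μ`.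

Proof. `Kerr.bilin_basisVector_add_smul_axialVector` writes `g(T + cΦ, T + cΦ)` as the rational
function `−1 + c² σ (r² + a²) + (2Mr / (r² + a² (1 − σ))) (1 − c a σ)²` of `r = r_a(x)` and
`σ = sin²θ = (r² − x₃²)/r² ∈ [0, 1]`. In the normalised variables `α = a/M`, `ρ = r₀/M`,
`t = (r − r₀)/M` this is (exact scaling, `shell_scale_identity`) the `M = 1` expression
`G((α, ρ, σ), t)`; at `t = 0` it is `< 0` by the algebraic heart of DRSR Lemma 4.7.1
(`Kerr.drsr_timelike_aux` at `M = 1`). The parameter set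
`P = {|α| ≤ a₁} × {ρ ∈ [r₊(1, α) + c₁, R]} × {σ ∈ [0, 1]}` is compact, `G` is continuous on
`P × [−c₁/2, c₁/2]` (all denominators are positive there), so the extreme value theorem gives a
margin `−2μ < 0` at the centres and Heine–Cantor (uniform continuity) thickens it to
`G ≤ −μ` on `P × [−d, d]` (`exists_uniform_neg_of_compact`). Pure algebra and compactness; no
named fact is used. The lemma is false at `a₁ = 1` (the margin degenerates like `κ²`): `a₁ < 1`
enters only through `|α| ≤ a₁ < 1` in `Kerr.drsr_timelike_aux`.

## References

* M. Dafermos, I. Rodnianski, Y. Shlapentokh-Rothman, *Decay for solutions of the wave equation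
  on Kerr exterior spacetimes III: the full subextremal case `|a| < M`*, Ann. of Math. 183 (2016)
  787–913, arXiv:1402.7034, Lemma 4.7.1 (key `DafermosRodnianskiShlapentokhrothman2014`).
* M. Dafermos, G. Holzegel, I. Rodnianski, M. Taylor, arXiv:2410.03639, §3.4 (the shells
  "sufficiently small to admit a timelike Killing field `∂_{t*} + α_n ∂_{φ*}`").
-/

-- the doubled `FinalStateConjecture.FinalStateConjecture` path component trips dupNamespace
set_option linter.dupNamespace false

noncomputable section

namespace Summit.FinalStateConjecture.FinalStateConjecture.Theorems.BulkKerrCaptureC2.KillingShells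

open Literature.Geometry.Lorentzian
open Set

/-! ### The abstract thickening step (extreme value theorem + Heine–Cantor) -/

/-- **Thickening a strict inequality off a compact parameter set.** If `P ⊆ ℝ³` is compact,
`G` is continuous on `P × [−e, e]` (`e > 0`) and `G(p, 0) < 0` for every `p ∈ P`, then there
are `0 < d ≤ e` and `μ > 0` with `G(p, t) ≤ −μ` for all `p ∈ P`, `|t| ≤ d`: the maximum of
`G(·, 0)` on the compact set `P × {0}` is some `−2μ < 0` (or `P = ∅`), and uniform continuity of
`G` on `P × [−e, e]` with tolerance `μ` supplies `d`. -/
private theorem exists_uniform_neg_of_compact {P : Set (ℝ × ℝ × ℝ)} (hP : IsCompact P)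
    {G : (ℝ × ℝ × ℝ) × ℝ → ℝ} {e : ℝ} (he : 0 < e)
    (hG : ContinuousOn G (P ×ˢ Icc (-e) e)) (hneg : ∀ p ∈ P, G (p, 0) < 0) :
    ∃ d : ℝ, 0 < d ∧ d ≤ e ∧ ∃ μ : ℝ, 0 < μ ∧
      ∀ p ∈ P, ∀ t : ℝ, |t| ≤ d → G (p, t) ≤ -μ := by
  have hQ : IsCompact (P ×ˢ Icc (-e) e) := hP.prod isCompact_Icc
  have h0 : (0 : ℝ) ∈ Icc (-e) e := ⟨by linarith, he.le⟩
  -- the margin at the centres `t = 0`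
  obtain ⟨μ, hμ, hμP⟩ : ∃ μ : ℝ, 0 < μ ∧ ∀ p ∈ P, G (p, 0) ≤ -(2 * μ) := by
    rcases P.eq_empty_or_nonempty with hPe | hPne
    · exact ⟨1, one_pos, fun p hp ↦ absurd hp (by simp [hPe])⟩
    · have hK : IsCompact (P ×ˢ ({0} : Set ℝ)) := hP.prod isCompact_singleton
      have hKQ : P ×ˢ ({0} : Set ℝ) ⊆ P ×ˢ Icc (-e) e :=
        prod_mono Subset.rfl (singleton_subset_iff.2 h0)
      obtain ⟨q, hqK, hqmax⟩ :=
        hK.exists_isMaxOn (hPne.prod (singleton_nonempty 0)) (hG.mono hKQ)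
      have hq2 : q.2 = 0 := mem_singleton_iff.1 hqK.2
      have hq0 : G q < 0 := by
        have hq : q = (q.1, (0 : ℝ)) := Prod.ext rfl hq2
        rw [hq]
        exact hneg q.1 hqK.1
      refine ⟨-G q / 2, by linarith, fun p hp ↦ ?_⟩
      have h := isMaxOn_iff.1 hqmax (p, 0) (mk_mem_prod hp rfl)
      linarith
  -- Heine–Cantor on `P × [−e, e]`
  obtain ⟨δ, hδ, hδG⟩ :=
    Metric.uniformContinuousOn_iff_le.1 (hQ.uniformContinuousOn_of_continuous hG) μ hμ
  refine ⟨min e δ, lt_min he hδ, min_le_left _ _, μ, hμ, fun p hp t ht ↦ ?_⟩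
  have hte : |t| ≤ e := ht.trans (min_le_left _ _)
  have htδ : |t| ≤ δ := ht.trans (min_le_right _ _)
  have hpt : (p, t) ∈ P ×ˢ Icc (-e) e := mk_mem_prod hp (abs_le.1 hte)
  have hp0 : (p, (0 : ℝ)) ∈ P ×ˢ Icc (-e) e := mk_mem_prod hp h0
  have hdist : dist (p, t) (p, (0 : ℝ)) ≤ δ := by
    rw [Prod.dist_eq, dist_self, Real.dist_eq, sub_zero, max_eq_right (abs_nonneg t)]
    exact htδ
  have h := hδG (p, t) hpt (p, 0) hp0 hdist
  rw [Real.dist_eq] at h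
  have h' := (abs_le.1 h).2
  linarith [hμP p hp]

/-! ### The normalised (`M = 1`) shell function: its parameter set and continuity -/

/-- **The normalised parameter set is compact.** The set of `(α, ρ, σ) ∈ ℝ³` with `|α| ≤ a₁`,
`r₊(1, α) + c₁ ≤ ρ ≤ R`, `0 ≤ σ ≤ 1` is closed (`α ↦ r₊(1, α) = 1 + √(1 − α²)` is continuous)
and contained in the box `[−a₁, a₁] × [1 + c₁, R] × [0, 1]` (`√ ≥ 0`). -/
private theorem isCompact_shellParamSet (a₁ c₁ R : ℝ) :
    IsCompact {p : ℝ × ℝ × ℝ | |p.1| ≤ a₁ ∧ Kerr.rPlus 1 p.1 + c₁ ≤ p.2.1 ∧ p.2.1 ≤ R ∧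
      0 ≤ p.2.2 ∧ p.2.2 ≤ 1} := by
  refine ((isCompact_Icc (a := -a₁) (b := a₁)).prod ((isCompact_Icc (a := 1 + c₁) (b := R)).prod
    (isCompact_Icc (a := (0 : ℝ)) (b := 1)))).of_isClosed_subset ?_ ?_
  · have hc : Continuous fun p : ℝ × ℝ × ℝ ↦ Kerr.rPlus 1 p.1 + c₁ := by
      unfold Kerr.rPlus
      fun_prop
    have ha : Continuous fun p : ℝ × ℝ × ℝ ↦ |p.1| := continuous_abs.comp continuous_fst
    have h21 : Continuous fun p : ℝ × ℝ × ℝ ↦ p.2.1 := by fun_prop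
    have h22 : Continuous fun p : ℝ × ℝ × ℝ ↦ p.2.2 := by fun_prop
    exact (isClosed_le ha continuous_const).inter <| (isClosed_le hc h21).inter <|
      (isClosed_le h21 continuous_const).inter <|
        (isClosed_le continuous_const h22).inter (isClosed_le h22 continuous_const)
  · rintro ⟨α, ρ, σ⟩ ⟨hα, hρ, hρR, hσ0, hσ1⟩
    have hs : 0 ≤ √((1 : ℝ) ^ 2 - α ^ 2) := Real.sqrt_nonneg _
    refine mk_mem_prod (abs_le.1 hα) (mk_mem_prod ⟨?_, hρR⟩ ⟨hσ0, hσ1⟩)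
    unfold Kerr.rPlus at hρ
    dsimp only at hρ ⊢
    linarith

/-- **Continuity of the normalised shell function.** The `M = 1` expression
`G((α, ρ, σ), t) = −1 + ω̂² σ (r̂² + α²) + (2 r̂ / (r̂² + α² (1 − σ))) (1 − ω̂ α σ)²`,
`ω̂ = ω(1, α, ρ) = 2αρ/(ρ² + α²)²`, `r̂ = ρ + t`, is continuous wherever `ρ > 0`, `ρ + t > 0`
and `σ ≤ 1` (all denominators are positive there). -/
private theorem continuousOn_shellFn :
    ContinuousOn (fun q : (ℝ × ℝ × ℝ) × ℝ ↦
        -1 + Kerr.drsrAngularVelocity 1 q.1.1 q.1.2.1 ^ 2 *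
            (q.1.2.2 * ((q.1.2.1 + q.2) ^ 2 + q.1.1 ^ 2)) +
          2 * 1 * (q.1.2.1 + q.2) / ((q.1.2.1 + q.2) ^ 2 + q.1.1 ^ 2 * (1 - q.1.2.2)) *
            (1 - Kerr.drsrAngularVelocity 1 q.1.1 q.1.2.1 * (q.1.1 * q.1.2.2)) ^ 2)
      {q | 0 < q.1.2.1 ∧ 0 < q.1.2.1 + q.2 ∧ q.1.2.2 ≤ 1} := by
  have hω : ContinuousOn (fun q : (ℝ × ℝ × ℝ) × ℝ ↦ Kerr.drsrAngularVelocity 1 q.1.1 q.1.2.1)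
      {q | 0 < q.1.2.1 ∧ 0 < q.1.2.1 + q.2 ∧ q.1.2.2 ≤ 1} := by
    unfold Kerr.drsrAngularVelocity
    refine ContinuousOn.div₀ (by fun_prop) (by fun_prop) ?_
    rintro q ⟨hρ, -, -⟩
    positivity
  have hD : ContinuousOn (fun q : (ℝ × ℝ × ℝ) × ℝ ↦
      2 * 1 * (q.1.2.1 + q.2) / ((q.1.2.1 + q.2) ^ 2 + q.1.1 ^ 2 * (1 - q.1.2.2)))
      {q | 0 < q.1.2.1 ∧ 0 < q.1.2.1 + q.2 ∧ q.1.2.2 ≤ 1} := by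
    refine ContinuousOn.div₀ (by fun_prop) (by fun_prop) ?_
    rintro q ⟨-, hr, hσ⟩
    have h1 : 0 < (q.1.2.1 + q.2) ^ 2 := pow_pos hr 2
    have h2 : 0 ≤ q.1.1 ^ 2 * (1 - q.1.2.2) := mul_nonneg (sq_nonneg _) (by linarith)
    exact (add_pos_of_pos_of_nonneg h1 h2).ne'
  exact (continuousOn_const.add ((hω.pow 2).mul (Continuous.continuousOn (by fun_prop)))).add
    (hD.mul ((continuousOn_const.sub (hω.mul (Continuous.continuousOn (by fun_prop)))).pow 2))

/-- **The normalised shell lemma (`M = 1`).** For `a₁ < 1`, `c₁ > 0` and `R` there are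
`0 < d ≤ c₁/2` and `μ > 0` such that `G((α, ρ, σ), t) ≤ −μ` whenever `|α| ≤ a₁`,
`r₊(1, α) + c₁ ≤ ρ ≤ R`, `0 ≤ σ ≤ 1` and `|t| ≤ d`. At `t = 0` the expression is `< 0` by the
algebraic heart of DRSR Lemma 4.7.1 (`Kerr.drsr_timelike_aux` at `M = 1`, `|α| ≤ a₁ < 1`,
`ρ > r₊`); compactness of the parameter set and continuity do the rest
(`exists_uniform_neg_of_compact`). -/
private theorem exists_shell_width_margin {a₁ c₁ : ℝ} (R : ℝ) (ha₁ : a₁ < 1) (hc₁ : 0 < c₁) :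
    ∃ d : ℝ, 0 < d ∧ d ≤ c₁ / 2 ∧ ∃ μ : ℝ, 0 < μ ∧
      ∀ α ρ σ t : ℝ, |α| ≤ a₁ → Kerr.rPlus 1 α + c₁ ≤ ρ → ρ ≤ R → 0 ≤ σ → σ ≤ 1 → |t| ≤ d →
        -1 + Kerr.drsrAngularVelocity 1 α ρ ^ 2 * (σ * ((ρ + t) ^ 2 + α ^ 2)) +
            2 * 1 * (ρ + t) / ((ρ + t) ^ 2 + α ^ 2 * (1 - σ)) *
              (1 - Kerr.drsrAngularVelocity 1 α ρ * (α * σ)) ^ 2 ≤ -μ := by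
  -- continuity on `P × [−c₁/2, c₁/2]`: there `ρ ≥ 1 + c₁ > 0`, `ρ + t ≥ 1 + c₁/2 > 0`, `σ ≤ 1`
  have hG : ContinuousOn (fun q : (ℝ × ℝ × ℝ) × ℝ ↦
      -1 + Kerr.drsrAngularVelocity 1 q.1.1 q.1.2.1 ^ 2 *
          (q.1.2.2 * ((q.1.2.1 + q.2) ^ 2 + q.1.1 ^ 2)) +
        2 * 1 * (q.1.2.1 + q.2) / ((q.1.2.1 + q.2) ^ 2 + q.1.1 ^ 2 * (1 - q.1.2.2)) *
          (1 - Kerr.drsrAngularVelocity 1 q.1.1 q.1.2.1 * (q.1.1 * q.1.2.2)) ^ 2)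
      ({p : ℝ × ℝ × ℝ | |p.1| ≤ a₁ ∧ Kerr.rPlus 1 p.1 + c₁ ≤ p.2.1 ∧ p.2.1 ≤ R ∧
        0 ≤ p.2.2 ∧ p.2.2 ≤ 1} ×ˢ Icc (-(c₁ / 2)) (c₁ / 2)) := by
    refine continuousOn_shellFn.mono ?_
    rintro ⟨⟨α, ρ, σ⟩, t⟩ ⟨⟨-, hρ, -, -, hσ1⟩, ht1, -⟩
    have hs : 0 ≤ √((1 : ℝ) ^ 2 - α ^ 2) := Real.sqrt_nonneg _
    unfold Kerr.rPlus at hρ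
    dsimp only at hρ hσ1 ht1 ⊢
    exact ⟨by linarith, by linarith, hσ1⟩
  -- negativity at the centres: DRSR Lemma 4.7.1 at `M = 1`
  have hneg : ∀ p ∈ {p : ℝ × ℝ × ℝ | |p.1| ≤ a₁ ∧ Kerr.rPlus 1 p.1 + c₁ ≤ p.2.1 ∧ p.2.1 ≤ R ∧
      0 ≤ p.2.2 ∧ p.2.2 ≤ 1},
      (fun q : (ℝ × ℝ × ℝ) × ℝ ↦
        -1 + Kerr.drsrAngularVelocity 1 q.1.1 q.1.2.1 ^ 2 *
            (q.1.2.2 * ((q.1.2.1 + q.2) ^ 2 + q.1.1 ^ 2)) +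
          2 * 1 * (q.1.2.1 + q.2) / ((q.1.2.1 + q.2) ^ 2 + q.1.1 ^ 2 * (1 - q.1.2.2)) *
            (1 - Kerr.drsrAngularVelocity 1 q.1.1 q.1.2.1 * (q.1.1 * q.1.2.2)) ^ 2) (p, 0) < 0 := by
    rintro ⟨α, ρ, σ⟩ ⟨hα, hρ, -, hσ0, hσ1⟩
    dsimp only at hα hρ hσ0 hσ1 ⊢
    rw [add_zero]
    exact Kerr.drsr_timelike_aux (M := 1) (hα.trans_lt ha₁) (by linarith) hσ0 hσ1
  obtain ⟨d, hd, hdc, μ, hμ, h⟩ :=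
    exists_uniform_neg_of_compact (isCompact_shellParamSet a₁ c₁ R) (half_pos hc₁) hG hneg
  exact ⟨d, hd, hdc, μ, hμ, fun α ρ σ t hα hρ hρR hσ0 hσ1 ht ↦
    h (α, ρ, σ) ⟨hα, hρ, hρR, hσ0, hσ1⟩ t ht⟩

/-! ### Exact scaling `(M, a, r₀, r) ↦ (1, a/M, r₀/M, r/M)` -/

/-- **Scale invariance of `g(T + ω(r₀)Φ, T + ω(r₀)Φ)`.** With `α = a/M`, `ρ = r₀/M`,
`t = (r − r₀)/M` (so `ρ + t = r/M`) and `ω(1, α, ρ) = M ω(M, a, r₀)`, the value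
`−1 + ω(M,a,r₀)² σ (r² + a²) + (2Mr/(r² + a²(1 − σ))) (1 − ω(M,a,r₀) a σ)²` equals the
normalised (`M = 1`) expression at `((α, ρ, σ), t)`. Pure algebra (`M > 0`, `r₀ > 0`,
`r² + a²(1 − σ) > 0`). -/
private theorem shell_scale_identity {M a r₀ r σ : ℝ} (hM : 0 < M) (hr₀ : 0 < r₀)
    (hD : 0 < r ^ 2 + a ^ 2 * (1 - σ)) :
    -1 + Kerr.drsrAngularVelocity M a r₀ ^ 2 * (σ * (r ^ 2 + a ^ 2)) +
        2 * M * r / (r ^ 2 + a ^ 2 * (1 - σ)) *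
          (1 - Kerr.drsrAngularVelocity M a r₀ * (a * σ)) ^ 2 =
      -1 + Kerr.drsrAngularVelocity 1 (a / M) (r₀ / M) ^ 2 *
          (σ * ((r₀ / M + (r - r₀) / M) ^ 2 + (a / M) ^ 2)) +
        2 * 1 * (r₀ / M + (r - r₀) / M) /
            ((r₀ / M + (r - r₀) / M) ^ 2 + (a / M) ^ 2 * (1 - σ)) *
          (1 - Kerr.drsrAngularVelocity 1 (a / M) (r₀ / M) * (a / M * σ)) ^ 2 := by
  have hM0 : M ≠ 0 := hM.ne'
  have hω : Kerr.drsrAngularVelocity 1 (a / M) (r₀ / M) = M * Kerr.drsrAngularVelocity M a r₀ := by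
    unfold Kerr.drsrAngularVelocity
    have hA : r₀ ^ 2 + a ^ 2 ≠ 0 := by positivity
    field_simp
  have ht : r₀ / M + (r - r₀) / M = r / M := by ring
  have h1 : (r / M) ^ 2 + (a / M) ^ 2 * (1 - σ) = (r ^ 2 + a ^ 2 * (1 - σ)) / M ^ 2 := by ring
  have h2 : (r / M) ^ 2 + (a / M) ^ 2 = (r ^ 2 + a ^ 2) / M ^ 2 := by ring
  rw [hω, ht, h1, h2]
  have hD0 : r ^ 2 + a ^ 2 * (1 - σ) ≠ 0 := hD.ne'
  field_simp

/-- `r₊(1, a/M) = r₊(M, a)/M` for `M > 0`: the horizon radius scales with the mass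
(`√(1 − (a/M)²) = √(M² − a²)/M`). -/
private theorem rPlus_one_div_mass {M : ℝ} (a : ℝ) (hM : 0 < M) :
    Kerr.rPlus 1 (a / M) = Kerr.rPlus M a / M := by
  unfold Kerr.rPlus
  have hM0 : M ≠ 0 := hM.ne'
  have h1 : (1 : ℝ) ^ 2 - (a / M) ^ 2 = (M ^ 2 - a ^ 2) / M ^ 2 := by
    field_simp
  rw [h1, Real.sqrt_div' _ (sq_nonneg M), Real.sqrt_sq hM.le]
  field_simp

/-! ### The stub -/

/-- **`S` — uniform timelike Killing shells at bounded surface gravity** (stub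
`stub_uniformKillingShells` of the line `bounded-kappa-closing-box` for the crux
`BulkKerrCaptureC2`). For every `a₁ < 1`, inner margin `c₁ > 0` and outer radius `R` there are
a shell half-width `d > 0` and a margin `μ > 0`, BOTH INDEPENDENT OF `(M, a)`, such that for
every `M > 0`, `|a| ≤ a₁ M`, every centre `r₀` with `r₊ + c₁ M ≤ r₀ ≤ R M` and every point `x`
of the Kerr–Schild chart with `|r_a(x) − r₀| ≤ d M`, the constant-coefficient Killing vector
`V = ∂₀ + ω(r₀) (x₁ ∂₂ − x₂ ∂₁)`, `ω(r₀) = 2 M a r₀/(r₀² + a²)²`, has `g_{M,a}(x)(V, V) ≤ −μ`.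
Proof: `Kerr.bilin_basisVector_add_smul_axialVector` + exact scaling to `M = 1`
(`shell_scale_identity`, `rPlus_one_div_mass`) + the normalised shell lemma
`exists_shell_width_margin` (DRSR Lemma 4.7.1 at the centres, thickened by compactness). The
shell-uniform quantitative form of Dafermos–Rodnianski–Shlapentokh-Rothman, arXiv:1402.7034,
Lemma 4.7.1. [cite: DafermosRodnianskiShlapentokhrothman2014, Lemma 4.7.1] -/
theorem stub_uniformKillingShells :
    ∀ a₁ : ℝ, a₁ < 1 → ∀ c₁ R : ℝ, 0 < c₁ → ∃ d > (0 : ℝ), ∃ μ > (0 : ℝ),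
      ∀ M : ℝ, 0 < M → ∀ a : ℝ, |a| ≤ a₁ * M →
        ∀ r₀ : ℝ, Kerr.rPlus M a + c₁ * M ≤ r₀ → r₀ ≤ R * M →
          ∀ x : E4, |Kerr.radius a x - r₀| ≤ d * M →
            Kerr.bilin M a x
                (E4.basisVector 0 + Kerr.drsrAngularVelocity M a r₀ • Kerr.axialVector x)
                (E4.basisVector 0 + Kerr.drsrAngularVelocity M a r₀ • Kerr.axialVector x) ≤ -μ := by
  intro a₁ ha₁ c₁ R hc₁
  obtain ⟨d, hd, hdc, μ, hμ, hmain⟩ := exists_shell_width_margin R ha₁ hc₁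
  refine ⟨d, hd, μ, hμ, fun M hM a ha r₀ hr₀ hr₀R x hx ↦ ?_⟩
  -- all radii in the shell are positive: `r ≥ r₀ − dM ≥ M + c₁M − (c₁/2)M > 0`
  have hrp : M ≤ Kerr.rPlus M a := by
    unfold Kerr.rPlus
    linarith [Real.sqrt_nonneg (M ^ 2 - a ^ 2)]
  have hc₁M : 0 < c₁ * M := mul_pos hc₁ hM
  have hr₀pos : 0 < r₀ := by linarith
  have hdM : d * M ≤ c₁ / 2 * M := mul_le_mul_of_nonneg_right hdc hM.le
  have hr : 0 < Kerr.radius a x := by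
    have h := (abs_le.1 hx).1
    linarith
  rw [Kerr.bilin_basisVector_add_smul_axialVector M a _ hr]
  obtain ⟨hσ0, hσ1⟩ := Kerr.sinSq_nonneg_and_le_one a hr
  set r := Kerr.radius a x
  set σ := (r ^ 2 - x 3 ^ 2) / r ^ 2
  have hD : 0 < r ^ 2 + a ^ 2 * (1 - σ) := by
    have : 0 ≤ a ^ 2 * (1 - σ) := mul_nonneg (sq_nonneg a) (by linarith)
    positivity
  rw [shell_scale_identity hM hr₀pos hD]
  refine hmain (a / M) (r₀ / M) σ ((r - r₀) / M) ?_ ?_ ?_ hσ0 hσ1 ?_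
  · rw [abs_div, abs_of_pos hM, div_le_iff₀ hM]
    exact ha
  · calc Kerr.rPlus 1 (a / M) + c₁ = (Kerr.rPlus M a + c₁ * M) / M := by
          rw [rPlus_one_div_mass a hM]
          field_simp
      _ ≤ r₀ / M := div_le_div_of_nonneg_right hr₀ hM.le
  · rw [div_le_iff₀ hM]
    exact hr₀R
  · rw [abs_div, abs_of_pos hM, div_le_iff₀ hM]
    exact hx

end Summit.FinalStateConjecture.FinalStateConjecture.Theorems.BulkKerrCaptureC2.KillingShells
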